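import Summits.QuantumFields.YangMills.Theorems.LuscherReductionTwistedTraceScalingSliceMeets
import Summits.QuantumFields.YangMills.Theorems.LuscherReductionTwistedTraceScalingRecordWeightConj
import Summits.QuantumFields.YangMills.Theorems.LuscherReductionRunningReductionCombGaugeBox
import Summits.QuantumFields.YangMills.Theorems.LuscherReductionRunningReductionCoarseUpperScales
import HarnessLib

/-!
# R29 — the `nearOne(2δ)` factor of the fat tube is LOAD-BEARING for the single-slice evaluation of the Faddeev–Popov weight (N2): the vacuum gauge slice
# `gaugeCoordSq = 0` meets the vacuum orbit inside `{orbitDist < δβ}` at the WINDING pure-gauge copies, at full Gaussian weight, for every `δ`, `δg`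
# (crux disprover of `TwistedTraceScaling`, stmt-QuantumFields-20203, cycle 23; `--supports` the crux; negative lane, def-free)

Lane A's C4-CORE architecture (COARSE-DESIGN §23.6–§23.8, `…RecordWeight`, `…SliceMeets`, `…RecordWeightConj`) evaluates the orbit integral
`N(U) = ∫ recordWeight(U^g) dg` of the weight of record `recordWeight δ δg β = 𝟙_{fatTube} · exp(−gaugeCoordSq/δg²)`, `fatTube = nearOne(2δβ) ∩ {orbitDist < δβ}`, by ONE
Gaussian around the slice point `U*` of the orbit ((N1) `exists_slicePoint`, (N2)).  This file records WHY the first factor of the fat tube cannot be dropped from any typed (N2):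
* ★ `winding_eq_constLift`: the winding gauge function `g(x) = diagSU2((2π/L)·x₀)` (well defined on the torus: `diagSU2_step`) carries the vacuum `1̄` to the CONSTANT configuration
  `constLift (diagSU2(−2π/L), 1, 1)` — a pure-gauge copy of the vacuum which is not on the vacuum sheet `{1̄^g : g ≈ const}`;
* ★ `orbitDist_conj_copy = 0`, ★ `gaugeCoordSq_conj_copy = 0`: the copy and all its colour conjugates `h·copy·h⁻¹` (`h ∈ SU(2)`: a 2-sphere of them per winding) lie on the vacuum
  ORBIT and on the SLICE `P_Γ relLinkVec = 0` (`relLinkVec_constLift`, `gaugeCoordSq_conj`);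
* ★★ `sliceWeight_without_nearOne_conj_copy`: hence the `nearOne`-FREE weight `𝟙_{orbitDist < δβ} · exp(−gaugeCoordSq/δg²)` equals `1` at every such copy, for EVERY `δ β > 0` and EVERY
  width `δg` — on `{orbitDist < δ}` alone the slice meets the vacuum orbit in (at least) `1 +` an `S²`-family of sheets, and «`N(U) = N(U*)` = one Gaussian» is false as a formula
  (paper: the winding sheet `{h·g·k}` has dimension 5 against the vacuum sheet's 3 — two MORE exact zero modes of `gaugeCoordSq`, the axis `n̂ ∈ S²` — so without the cut the
  winding sheets would carry a Gaussian volume `≳ δg^{−2}` times the vacuum sheet's, and since the `n̂`-degeneracy is lifted at stiff amplitude `|w| ≳ δg` the weight `N` would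
  vary by an `O(1)` FACTOR across the core `|w| ≲ β^{−s}`, `δg = β^{−t}`, `t > s` — not by `o(λ_b)`);
* ★★ `conj_copy_not_mem_nearOne` / `recordWeight_conj_copy_eq_zero` / `recordWeight_pow_conj_copy_eventually_zero`: WITH the factor the copies are excluded as soon as
  `2δβ ≤ 2√(1 − cos(2π/L))` (`= 2√2·sin(π/L)`), in particular eventually in `β` for `δ = powScale s`, `s > 0` — the weight OF RECORD is fine; the lemma is a guard for re-typings
  («tube = {orbitDist < δ}», «N on the inner region») and for any uniqueness claim about slice points on an inner orbit.
HONEST FRAMING: finite-lattice gauge bookkeeping for a stub (S-BASE, C4-CORE) of a child of the CONDITIONAL reduction route R2b1 (femto rung); no kernel estimate refuted or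
proved; C4 OPEN; not infinite volume, not a gap, not Clay.

## References
* M. Lüscher, Some analytic results concerning the mass spectrum of Yang–Mills gauge theories on a torus, Nucl. Phys. B219 (1983) 233–261, §2–3 (gauge fixing around the
  torons; Gribov-type copies on the torus). [Luscher1983]
-/

set_option autoImplicit false

noncomputable section

open Real
open Literature.MathematicalPhysics.QuantumFieldTheory hiding SU2
open Literature.MathematicalPhysics.QuantumLattice

namespace Summit.QuantumFields.YangMills.Theorems.TwistedTraceScaling.Negative.R29

open Summit.QuantumFields.YangMills.Theorems.FemtoTransferGap
open Summit.QuantumFields.YangMills.Theorems.FemtoTransferGap.TwoLattice.Toron (diagSU2_add diagSU2_neg diagSU2_zero diagSU2_pi)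
open Summit.QuantumFields.YangMills.Theorems.FemtoTransferGap.TwoLattice.ConstTube

variable {L : ℕ} [NeZero L]

/-! ## §1 The winding gauge function on the torus -/

omit [NeZero L] in
/-- `diagSU2 (2π) = 1`. [folklore] -/
theorem diagSU2_two_pi : diagSU2 (2 * π) = 1 := by
  rw [two_mul, diagSU2_add, diagSU2_pi, negOne_mul_negOne]

omit [NeZero L] in
/-- `diagSU2 (q·2π) = 1` for natural `q`. [folklore] -/
theorem diagSU2_nat_mul_two_pi (q : ℕ) : diagSU2 ((q : ℝ) * (2 * π)) = 1 := by
  induction q with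
  | zero => rw [Nat.cast_zero, zero_mul, diagSU2_zero]
  | succ q ih => rw [Nat.cast_succ, add_mul, one_mul, diagSU2_add, ih, diagSU2_two_pi, one_mul]

/-- ★ The winding phase is a character of `ℤ/L`: `diagSU2((2π/L)·(a+1)) = diagSU2((2π/L)·a) · diagSU2(2π/L)` (values read through `ZMod.val`; the wrap-around
`L − 1 ↦ 0` costs a full turn `diagSU2(2π) = 1`). [folklore] -/
theorem diagSU2_step (hL : 2 ≤ L) (a : ZMod L) :
    diagSU2 (2 * π / L * ((a + 1).val : ℝ)) = diagSU2 (2 * π / L * (a.val : ℝ)) * diagSU2 (2 * π / L) := by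
  haveI : Fact (1 < L) := ⟨by omega⟩
  set q : ℕ := (a.val + 1) / L with hq
  have hv : (((a + 1).val : ℕ) : ℝ) = (a.val : ℝ) + 1 - (L : ℝ) * (q : ℝ) := by
    have h1 : (a + 1).val = (a.val + 1) % L := by rw [ZMod.val_add, ZMod.val_one]
    have h2 : (a.val + 1) % L + L * q = a.val + 1 := Nat.mod_add_div (a.val + 1) L
    rw [h1, eq_sub_iff_add_eq]
    exact_mod_cast h2
  have hL0 : (L : ℝ) ≠ 0 := by exact_mod_cast (show L ≠ 0 by omega)
  have harg : 2 * π / L * (((a + 1).val : ℕ) : ℝ) = 2 * π / L * (a.val : ℝ) + 2 * π / L + -((q : ℝ) * (2 * π)) := by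
    rw [hv]; field_simp; ring
  rw [harg, diagSU2_add, diagSU2_add, diagSU2_neg, diagSU2_nat_mul_two_pi, inv_one, mul_one]

/-- ★ The links of the winding transform of the vacuum: `(1̄^g)_{(x,k)} = diagSU2(−2π/L)` for `k = 0` and `1` otherwise, `g(x) = diagSU2((2π/L)·x₀)`. [cite: Luscher1983, §2] -/
theorem winding_apply (hL : 2 ≤ L) (x : Site 3 L) (k : Fin 3) :
    gaugeTransform (fun y : Site 3 L => diagSU2 (2 * π / L * ((y 0).val : ℝ))) (fun _ : Edge 3 L => (1 : SU2)) (x, k) =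
      if k = 0 then diagSU2 (-(2 * π / L)) else 1 := by
  simp only [gaugeTransform, Site.shift, mul_one, Pi.add_apply]
  by_cases hk : k = 0
  · subst hk
    rw [if_pos rfl, Pi.single_eq_same, diagSU2_step hL, ← diagSU2_add, ← diagSU2_neg, ← diagSU2_add]
    congr 1
    ring
  · rw [if_neg hk, Pi.single_eq_of_ne (Ne.symm hk), add_zero, mul_inv_cancel]

/-- ★ **THE WINDING COPY OF THE VACUUM**: `1̄^g = constLift (diagSU2(−2π/L), 1, 1)` — a CONSTANT configuration, pure gauge, not on the vacuum sheet. [cite: Luscher1983, §2] -/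
theorem winding_eq_constLift (hL : 2 ≤ L) :
    gaugeTransform (fun y : Site 3 L => diagSU2 (2 * π / L * ((y 0).val : ℝ))) (fun _ : Edge 3 L => (1 : SU2)) =
      constLift L (fun e : Edge 3 1 => if e.2 = 0 then diagSU2 (-(2 * π / L)) else 1) := by
  funext e
  obtain ⟨x, k⟩ := e
  rw [winding_apply hL x k, constLift_apply]

/-! ## §2 The copies lie on the vacuum orbit and on the slice -/

/-- ★ The winding copy is on the vacuum ORBIT: `orbitDist = 0`. [cite: Luscher1983, §2] -/
theorem orbitDist_copy (hL : 2 ≤ L) : orbitDist (constLift L (fun e : Edge 3 1 => if e.2 = 0 then diagSU2 (-(2 * π / L)) else 1)) = 0 := by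
  rw [← winding_eq_constLift hL, orbitDist_gaugeTransform, orbitDist_one]

/-- ★ Every colour conjugate `h·copy·h⁻¹` is on the vacuum orbit. [cite: Luscher1983, §2] -/
theorem orbitDist_conj_copy (hL : 2 ≤ L) (h : SU2) :
    orbitDist (gaugeTransform (fun _ : Site 3 L => h) (constLift L (fun e : Edge 3 1 => if e.2 = 0 then diagSU2 (-(2 * π / L)) else 1))) = 0 := by
  rw [orbitDist_gaugeTransform, orbitDist_copy hL]

/-- ★ Every constant configuration is on the SLICE `P_Γ relLinkVec = 0`: `gaugeCoordSq (constLift u) = 0`. [folklore] -/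
theorem gaugeCoordSq_constLift (u : GaugeConfig 3 1 SU2) : gaugeCoordSq L (constLift L u) = 0 := by
  unfold gaugeCoordSq
  rw [relLinkVec_constLift, map_zero, norm_zero, zero_pow two_ne_zero]

/-- ★ Every colour conjugate of the winding copy is on the slice. [folklore] -/
theorem gaugeCoordSq_conj_copy (h : SU2) :
    gaugeCoordSq L (gaugeTransform (fun _ : Site 3 L => h) (constLift L (fun e : Edge 3 1 => if e.2 = 0 then diagSU2 (-(2 * π / L)) else 1))) = 0 := by
  rw [gaugeCoordSq_conj, gaugeCoordSq_constLift]

/-! ## §3 Without `nearOne` the copies carry full weight; with it they are excluded -/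

/-- ★★ **WITHOUT THE `nearOne` FACTOR THE COPIES CARRY FULL WEIGHT**: the `nearOne`-free slice weight `𝟙_{orbitDist < δβ}·exp(−gaugeCoordSq/δg²)` equals `1` at every colour
conjugate of the winding copy, for EVERY `δ β > 0` and EVERY width `δg`. [cite: Luscher1983, §2–3] -/
theorem sliceWeight_without_nearOne_conj_copy (hL : 2 ≤ L) (δ δg : ℝ → ℝ) (β : ℝ) (hδ : 0 < δ β) (h : SU2) :
    {W : GaugeConfig 3 L SU2 | orbitDist W < δ β}.indicator (fun _ => (1 : ℝ))
          (gaugeTransform (fun _ : Site 3 L => h) (constLift L (fun e : Edge 3 1 => if e.2 = 0 then diagSU2 (-(2 * π / L)) else 1))) *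
        Real.exp (-(gaugeCoordSq L (gaugeTransform (fun _ : Site 3 L => h)
          (constLift L (fun e : Edge 3 1 => if e.2 = 0 then diagSU2 (-(2 * π / L)) else 1))) / δg β ^ 2)) = 1 := by
  rw [gaugeCoordSq_conj_copy, zero_div, neg_zero, Real.exp_zero, mul_one, Set.indicator_of_mem]
  show orbitDist _ < δ β
  rw [orbitDist_conj_copy hL]
  exact hδ

omit [NeZero L] in
/-- The Frobenius distance of the copy's winding link from `1`: `‖diagSU2(−2π/L) − 1‖_F = 2√(1 − cos(2π/L))`. [folklore] -/
theorem frobNorm_copyLink : frobNorm (((diagSU2 (-(2 * π / L)) : SU2) : Matrix (Fin 2) (Fin 2) ℂ) - 1) = 2 * √(1 - Real.cos (2 * π / L)) := by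
  have hsq := frobNorm_diagSU2_sub_one_sq (-(2 * π / (L : ℝ)))
  rw [Real.cos_neg] at hsq
  have hnn : 0 ≤ frobNorm (((diagSU2 (-(2 * π / L)) : SU2) : Matrix (Fin 2) (Fin 2) ℂ) - 1) := frobNorm_nonneg _
  have h1 : 0 ≤ 1 - Real.cos (2 * π / L) := by linarith [Real.cos_le_one (2 * π / L)]
  rw [← Real.sqrt_sq hnn, hsq, show (4 : ℝ) * (1 - Real.cos (2 * π / L)) = 2 ^ 2 * (1 - Real.cos (2 * π / L)) by norm_num,
    Real.sqrt_mul (by norm_num) , Real.sqrt_sq (by norm_num : (0 : ℝ) ≤ 2)]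

omit [NeZero L] in
/-- For `L ≥ 2` the winding link is genuinely away from `1`: `0 < 1 − cos(2π/L)`. [folklore] -/
theorem one_sub_cos_pos (hL : 2 ≤ L) : 0 < 1 - Real.cos (2 * π / L) := by
  have hLpos : (0 : ℝ) < L := by exact_mod_cast (show 0 < L by omega)
  have hL2 : (2 : ℝ) ≤ L := by exact_mod_cast hL
  have hx : 0 < 2 * π / L := div_pos Real.two_pi_pos hLpos
  have hx2 : 2 * π / L < 2 * π := by
    rw [div_lt_iff₀ hLpos]; nlinarith [Real.pi_pos]
  have hne : Real.cos (2 * π / L) ≠ 1 := by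
    intro h1
    have := (Real.cos_eq_one_iff_of_lt_of_lt (by linarith) hx2).1 h1
    linarith
  have hle := Real.cos_le_one (2 * π / L)
  exact sub_pos.2 (lt_of_le_of_ne hle hne)

omit [NeZero L] in
/-- ★★ **WITH THE `nearOne` FACTOR THE COPIES ARE EXCLUDED**: no colour conjugate of the winding copy is in `nearOne ρ` once `ρ ≤ 2√(1 − cos(2π/L))`. [cite: Luscher1983, §2] -/
theorem conj_copy_not_mem_nearOne {ρ : ℝ} (hρ : ρ ≤ 2 * √(1 - Real.cos (2 * π / L))) (h : SU2) :
    gaugeTransform (fun _ : Site 3 L => h) (constLift L (fun e : Edge 3 1 => if e.2 = 0 then diagSU2 (-(2 * π / L)) else 1)) ∉ nearOne L ρ := by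
  intro hmem
  rw [nearOne, Set.mem_setOf_eq] at hmem
  have hlink := hmem ((0 : Site 3 L), (0 : Fin 3))
  rw [gaugeTransform_const_apply, constLift_apply, frobNorm_conj_sub_one] at hlink
  dsimp only at hlink
  rw [if_pos rfl, frobNorm_copyLink] at hlink
  exact absurd (hlink.trans_le hρ) (lt_irrefl _)

/-- ★★ Hence the weight OF RECORD vanishes at every copy as soon as `2δβ ≤ 2√(1 − cos(2π/L))` (every width `δg`). [cite: Luscher1983, §2–3] -/
theorem recordWeight_conj_copy_eq_zero (δ δg : ℝ → ℝ) (β : ℝ) (hδ : 2 * δ β ≤ 2 * √(1 - Real.cos (2 * π / L))) (h : SU2) :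
    recordWeight L δ δg β (gaugeTransform (fun _ : Site 3 L => h) (constLift L (fun e : Edge 3 1 => if e.2 = 0 then diagSU2 (-(2 * π / L)) else 1))) = 0 := by
  unfold recordWeight
  rw [Set.indicator_of_notMem, zero_mul]
  intro hmem
  exact conj_copy_not_mem_nearOne hδ h hmem.1

/-- ★★ In the currency of record (`δ = powScale s`, `s > 0`): eventually in `β`, the record weight vanishes at every copy and every width, while the `nearOne`-free slice weight is `1`
there (`sliceWeight_without_nearOne_conj_copy` with `powScale_pos`) — the `nearOne(2δ)` factor is what separates the vacuum sheet from the winding sheets. [cite: Luscher1983, §2–3] -/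
theorem recordWeight_pow_conj_copy_eventually_zero (hL : 2 ≤ L) {s : ℝ} (hs : 0 < s) (δg : ℝ → ℝ) :
    ∃ β0 : ℝ, ∀ β : ℝ, β0 ≤ β → ∀ h : SU2,
      recordWeight L (powScale s) δg β (gaugeTransform (fun _ : Site 3 L => h)
          (constLift L (fun e : Edge 3 1 => if e.2 = 0 then diagSU2 (-(2 * π / L)) else 1))) = 0 ∧
        {W : GaugeConfig 3 L SU2 | orbitDist W < powScale s β}.indicator (fun _ => (1 : ℝ))
            (gaugeTransform (fun _ : Site 3 L => h) (constLift L (fun e : Edge 3 1 => if e.2 = 0 then diagSU2 (-(2 * π / L)) else 1))) *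
          Real.exp (-(gaugeCoordSq L (gaugeTransform (fun _ : Site 3 L => h)
            (constLift L (fun e : Edge 3 1 => if e.2 = 0 then diagSU2 (-(2 * π / L)) else 1))) / δg β ^ 2)) = 1 := by
  obtain ⟨β0, hβ0⟩ := powScale_eventually_le hs (Real.sqrt_pos.2 (one_sub_cos_pos hL))
  refine ⟨β0, fun β hβ h => ⟨recordWeight_conj_copy_eq_zero _ δg β ?_ h, sliceWeight_without_nearOne_conj_copy hL _ δg β (powScale_pos s β) h⟩⟩
  linarith [hβ0 β hβ]

omit [NeZero L] in
/-- ★ The copies are NOT the vacuum (for `L ≥ 2`): a second family of slice points on the vacuum orbit. [cite: Luscher1983, §2] -/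
theorem conj_copy_ne_one (hL : 2 ≤ L) (h : SU2) :
    gaugeTransform (fun _ : Site 3 L => h) (constLift L (fun e : Edge 3 1 => if e.2 = 0 then diagSU2 (-(2 * π / L)) else 1)) ≠ fun _ => 1 := by
  intro heq
  have hlink := congrFun heq ((0 : Site 3 L), (0 : Fin 3))
  rw [gaugeTransform_const_apply, constLift_apply] at hlink
  dsimp only at hlink
  rw [if_pos rfl] at hlink
  have hnorm := congrArg (fun W : SU2 => frobNorm ((W : Matrix (Fin 2) (Fin 2) ℂ) - 1)) hlink
  rw [frobNorm_conj_sub_one, frobNorm_copyLink, OneMemClass.coe_one, sub_self, frobNorm_zero] at hnorm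
  have hpos : 0 < √(1 - Real.cos (2 * π / L)) := Real.sqrt_pos.2 (one_sub_cos_pos hL)
  linarith

end Summit.QuantumFields.YangMills.Theorems.TwistedTraceScaling.Negative.R29

end
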